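/-
Copyright (c) 2026. Released under the Apache 2.0 license.
-/
import Mathlib

/-!
# B3 — Bałaban, *(Higgs)₂,₃ quantum fields in a finite volume. III. Renormalization*,
Commun. Math. Phys. **88**, 411–445 (1983) — the one item cited downstream: (2.6)–(2.7), pp. 424–425

[cite: Balaban1983Higgs3] (B3 of the pub-balaban INDEX; held text `paper:balaban1983-higgs-2-3-quantum-fields-finite-volume`,
journal page = PDF page + 410; quotations below transcribed from the ×2 renders
`b2b-balaban-ref1/pages/1983-cmp88-higgs23-III/1983-cmp88-higgs23-III-p014-x2.png`, `…-p015-x2.png`, not from the OCR layer).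

## Why this file exists (cell pub-balaban, PHASE-2 row P00: "B1–B3 — ONLY the items cited by B4–B16")

Of this paper a SINGLE display is cited by a later paper of the series: **(2.7)** p. 425 [PDF 15], by
B12 = Bałaban, CMP **109** (1987) [Balaban1987RG1] (where this paper is reference [7]):
* p. 256 [PDF 8] (render `…/1987-cmp109-rg-I-small-field/…-p008-x2.png`): "Each action was represented as a sum of
  localized contributions coming from integrations in successive renormalization transformations, i.e. see the sums
  over j in (2.7) [7], (41), (47) [16]. This representation is important here also.";
* p. 260 [PDF 12]: "The inductive assumption is based on the results of the previous papers, e.g. see (2.7) [7], (41),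
  (47) [16], and on the general remarks in the previous section." ([16] = B10, CMP 102:255.)

Located, NOT typed (no statement is imported there): B12 p. 283 "(2.23)–(2.28) [7]" (the Ward–Takahashi identities of
the abelian Higgs model, cited as the pattern for B12 (4.9)), p. 285 "(3.25)–(3.32) [7]" and p. 288 "(3.10) [7]" (a
lattice Taylor formula) are citations of METHOD; B12 p. 285 "Proposition 5 [7] on functional derivatives of averaging
operations" cannot refer to this paper, which contains Propositions 1, 2.1 and 2.2 only — the statement meant is
evidently Prop. 5 of [12] = B7, CMP 98 (`B7.Prop5Printed`, "The functional derivative of Q_k(U₀, ηA) is a bounded …");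
B4 (CMP 89) p. 590 cites this paper as [3] precisely in order NOT to use it ("Formally we could rely on the estimates
of perturbative expansions in the third paper [3], but there they were derived in a different setting, …, so let us
repeat this part of the argument."); B10 pp. 255, 262 cite it ("[10]") for the method; B5–B9, B11, B13–B16 do not
cite it.  HONEST FRAMING: nothing analytic of this paper (the bounds (2.5), (1.33), Propositions 1, 2.1, 2.2) is
modelled or asserted here; value = typed skeleton of the cited display, NOT summit progress.

## The source text, verbatim (p. 424 line 18 – p. 425 line 6)

"Our first step in the proof of the theorem [= Proposition 2.1, p. 424] is to write the expression
E(G, {□(v)}_{v∈G}, Φ_ext, A_ext) = E(G′, {□(v)}_{v∈G}, Φ′_ext, A_ext)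
as a sum obtained by decomposing all the propagators corresponding to the lines of G′ according to the equality

  G_k(Ω, B̃) = C^{(0),η}(Ω, B̃) + Σ_{j=1}^{k−1} a_j² (L^j η)^{−4} G_j^η(Ω, B̃) Q_j^*(B̃) C^{(j),L^jη}(Ω, B̃) · Q_j(B̃) G_j^η(Ω, B̃)
            = Σ_{j=0}^{k−1} G^η_{(j)}(Ω, B̃),                                                                    (2.6)

and the similar equality for the vector field propagator. Thus we get a sum of new expressions obtained by replacing
in each line l of the graph G′ the corresponding propagator by a propagator G^η_{(j_l)}, 0 ≤ j_l ≤ k − 1. Let us add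
index j_l to the line and let us denote by G′(j) the graph G′ with indices added, j = {j_l}_{l∈G′}. We can write E(G′)
as a sum Σ_j E(G′(j)). The part of this sum with indices j different can be represented in a natural way as a sum
over orderings of the lines and for fixed ordering l̃ = {l(1), …, l(m)} a sum over indices j satisfying the condition
j_{l(1)} < j_{l(2)} < … < j_{l(m)}. This sum can be supplemented to the sum over all indices j if equalities are
admitted in the above condition. Thus for each ordering l̃ we assign some set J(l̃) of the indices j satisfying the
condition
                                   j_{l(1)} ≤ j_{l(2)} ≤ … ≤ j_{l(m)}
in such a way that ⋃_{l̃} J(l̃) is the set of all indices and the components of this union are disjoint sets. We get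
the equality

  E(G′, {□(v)}_{v∈G}, Φ′_ext, A_ext) = Σ_{orderings l̃} Σ_{j∈J(l̃)} E(G′(j), {□(v)}_{v∈G}, Φ′_ext, A_ext).          (2.7)

To prove the theorem it is sufficient to prove the estimate (1.33) for the sum with fixed ordering l̃ on the right
side above. This reduction is an important, although very simple, step in the proof because an order of summations
over indices j is fixed now."

## Typed reading (the dictionary)

* the m lines of G′ ↦ `Fin m`; the scale indices 0 ≤ j_l ≤ k − 1 ↦ `Fin k`; a multi-index j = {j_l}_{l∈G′} ↦ `j : Fin m → Fin k`;
* an ordering l̃ = {l(1), …, l(m)} of the lines ↦ a permutation `σ : Equiv.Perm (Fin m)` (`σ i` = the line l(i+1));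
* "j_{l(1)} ≤ j_{l(2)} ≤ … ≤ j_{l(m)}" ↦ `Monotone (j ∘ σ)` (`OrderedAlong`); "< … <" ↦ `StrictMono (j ∘ σ)` (`StrictlyOrderedAlong`);
* the assignment l̃ ↦ J(l̃) with its three printed properties ↦ the structure `Assignment`;
* the graph expression enters ONLY as an arbitrary function `F : (Fin m → Fin k) → W` (j ↦ E(G′(j))) into an additive
  commutative monoid — this is all (2.7) uses — resp., for the sentence "We can write E(G′) as a sum Σ_j E(G′(j))", as
  a map `E` that is MULTILINEAR in the family of the m line propagators (in the paper E(G, …) of Sect. 1 is a sum over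
  vertex positions of products in which each line of the graph contributes its propagator kernel as exactly one
  factor); the decomposition (2.6) of the propagator of line l is an arbitrary family `P l : Fin k → V` with sum the
  propagator.  Lattices, fields, propagators, localizations are not modelled.

KERNEL-CHECKED here (all elementary bookkeeping): `display26_of_firstForm` ((2.6): its first form equals its second);
`sum_multiIndex` ("E(G′) = Σ_j E(G′(j))" for multilinear E — Mathlib's `MultilinearMap.map_sum`); `Assignment.bySort`
(an assignment J with the printed properties EXISTS: J(l̃) := the multi-indices whose sorting permutation `Tuple.sort`
is l̃); `Assignment.biUnion_eq_univ`; **`display27`** = (2.7) for every assignment; `display27_multilinear` ((2.6) and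
(2.7) chained); `existsUnique_strictlyOrderedAlong` + `display27_strict` (the sentence on "indices j different": for
pairwise different indices the ordering is unique, so that part of the sum IS the sum over orderings of the strictly
ordered sums — here nothing has to be chosen).
-/

namespace Literature.MathematicalPhysics.QuantumFieldTheory.Balaban1983to89.B3

open Finset

/-! ### (2.6) — the multiscale decomposition of a propagator -/

/-- **(2.6)** p. 424, second form: "G_k(Ω, B̃) = Σ_{j=0}^{k−1} G^η_{(j)}(Ω, B̃)" — typed over an arbitrary additive
commutative monoid `R` of "operators": `Gk` is the propagator, `piece j` = G^η_{(j)}.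
[cite: Balaban1983Higgs3, (2.6) p.424] -/
def Display26 {R : Type} [AddCommMonoid R] (Gk : R) (piece : ℕ → R) (k : ℕ) : Prop :=
  Gk = ∑ j ∈ Finset.range k, piece j

/-- kernel: the FIRST form of (2.6), "G_k = C^{(0),η} + Σ_{j=1}^{k−1} T_j" with
T_j = a_j²(L^jη)^{−4} G_j^η Q_j^* C^{(j),L^jη} Q_j G_j^η (this is (2.43) of [B1] on the η-lattice, cf.
`B1.display243_of_242`), IS the second form with G^η_{(0)} := C^{(0),η} and G^η_{(j)} := T_j for 1 ≤ j ≤ k − 1.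
[folklore] -/
theorem display26_of_firstForm {R : Type} [AddCommMonoid R] (Gk C0 : R) (T : ℕ → R) (k : ℕ) (hk : 1 ≤ k)
    (h : Gk = C0 + ∑ j ∈ Finset.Ico 1 k, T j) :
    Display26 Gk (fun j => if j = 0 then C0 else T j) k := by
  unfold Display26
  rw [Finset.range_eq_Ico, Finset.sum_eq_sum_Ico_succ_bot hk, h]
  simp only [if_true]
  congr 1
  refine Finset.sum_congr rfl fun j hj => ?_
  have hj1 : 1 ≤ j := (Finset.mem_Ico.1 hj).1
  have hj0 : j ≠ 0 := by omega
  simp [hj0]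

/-! ### "We can write E(G′) as a sum Σ_j E(G′(j))" -/

/-- typed reading of the two sentences after (2.6): if the graph expression is a map `E` MULTILINEAR in the family of the
m line propagators and the propagator of line `l` is decomposed as `Σ_{j : Fin k} P l j` ((2.6) "and the similar equality
for the vector field propagator"), then E(G′) = Σ_{j = {j_l}} E(G′(j)), the sum over ALL multi-indices `j : Fin m → Fin k`,
where G′(j) carries the propagator `P l (j l)` on line `l`.  Kernel: Mathlib `MultilinearMap.map_sum`.
[cite: Balaban1983Higgs3, p.424 "We can write E(G′) as a sum Σ_j E(G′(j))"] -/
theorem sum_multiIndex {S V W : Type} [CommSemiring S] [AddCommMonoid V] [AddCommMonoid W] [Module S V]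
    [Module S W] {m k : ℕ} (E : MultilinearMap S (fun _ : Fin m => V) W) (P : Fin m → Fin k → V) :
    E (fun l => ∑ j : Fin k, P l j) = ∑ j : Fin m → Fin k, E (fun l => P l (j l)) :=
  E.map_sum P

/-! ### Orderings of the lines, the sets J(l̃), and (2.7) -/

/-- "for fixed ordering l̃ = {l(1), …, l(m)} a sum over indices j satisfying the condition j_{l(1)} ≤ j_{l(2)} ≤ … ≤ j_{l(m)}":
an ordering of the m lines is a permutation `σ` of `Fin m` (`σ i` = the (i+1)-st line of the ordering) and the
condition is that `j ∘ σ` is monotone. [cite: Balaban1983Higgs3, p.424] -/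
def OrderedAlong {m k : ℕ} (σ : Equiv.Perm (Fin m)) (j : Fin m → Fin k) : Prop :=
  Monotone (j ∘ σ)

/-- "indices j satisfying the condition j_{l(1)} < j_{l(2)} < … < j_{l(m)}" (the part "with indices j different").
[cite: Balaban1983Higgs3, p.424] -/
def StrictlyOrderedAlong {m k : ℕ} (σ : Equiv.Perm (Fin m)) (j : Fin m → Fin k) : Prop :=
  StrictMono (j ∘ σ)

/-- "Thus for each ordering l̃ we assign some set J(l̃) of the indices j satisfying the condition
j_{l(1)} ≤ j_{l(2)} ≤ … ≤ j_{l(m)} in such a way that ⋃_{l̃} J(l̃) is the set of all indices and the components of this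
union are disjoint sets." — the three printed requirements on l̃ ↦ J(l̃), as fields.
[cite: Balaban1983Higgs3, pp.424–425] -/
structure Assignment (m k : ℕ) where
  /-- l̃ ↦ J(l̃) -/
  J : Equiv.Perm (Fin m) → Finset (Fin m → Fin k)
  /-- every j ∈ J(l̃) satisfies j_{l(1)} ≤ … ≤ j_{l(m)} -/
  ordered : ∀ σ, ∀ j ∈ J σ, OrderedAlong σ j
  /-- "⋃_{l̃} J(l̃) is the set of all indices" -/
  covers : ∀ j, ∃ σ, j ∈ J σ
  /-- "the components of this union are disjoint sets" -/
  disjoint : ∀ σ τ, σ ≠ τ → Disjoint (J σ) (J τ)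

/-- kernel: an assignment with the printed properties EXISTS — J(l̃) := the multi-indices j whose sorting permutation
`Tuple.sort j` equals l̃ (every j is weakly increasing along `Tuple.sort j`: `Tuple.monotone_sort`).  The paper only
says "we assign some set J(l̃)"; this is one admissible choice. [folklore] -/
noncomputable def Assignment.bySort (m k : ℕ) : Assignment m k := by
  classical
  exact
    { J := fun σ => Finset.univ.filter (fun j : Fin m → Fin k => Tuple.sort j = σ)
      ordered := by
        intro σ j hj
        have h : Tuple.sort j = σ := (Finset.mem_filter.1 hj).2
        rw [← h]
        exact Tuple.monotone_sort j
      covers := fun j => ⟨Tuple.sort j, Finset.mem_filter.2 ⟨Finset.mem_univ _, rfl⟩⟩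
      disjoint := by
        intro σ τ hne
        rw [Finset.disjoint_left]
        intro j h1 h2
        exact hne (((Finset.mem_filter.1 h1).2).symm.trans (Finset.mem_filter.1 h2).2) }

/-- kernel: assignments with the printed properties exist (witness `Assignment.bySort`). [folklore] -/
theorem Assignment.nonempty (m k : ℕ) : Nonempty (Assignment m k) :=
  ⟨Assignment.bySort m k⟩

/-- kernel: "⋃_{l̃} J(l̃) is the set of all indices", as a `Finset` identity. [folklore] -/
theorem Assignment.biUnion_eq_univ {m k : ℕ} [DecidableEq (Fin m → Fin k)] (A : Assignment m k) :
    Finset.univ.biUnion A.J = Finset.univ := by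
  ext j
  simp only [Finset.mem_biUnion, Finset.mem_univ, true_and, iff_true]
  exact A.covers j

/-- **(2.7)** p. 425: "E(G′, {□(v)}_{v∈G}, Φ′_ext, A_ext) = Σ_{orderings l̃} Σ_{j∈J(l̃)} E(G′(j), {□(v)}_{v∈G}, Φ′_ext, A_ext)",
given "E(G′) = Σ_j E(G′(j))" (here: the left side IS that sum, `F j` = E(G′(j), …)) and ANY assignment l̃ ↦ J(l̃) with the
printed properties.  Kernel: a sum over a set partitioned into disjoint classes (`Finset.sum_biUnion`); nothing is
assumed about `F`. [cite: Balaban1983Higgs3, (2.7) p.425] -/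
theorem display27 {W : Type} [AddCommMonoid W] {m k : ℕ} (A : Assignment m k) (F : (Fin m → Fin k) → W) :
    ∑ j : Fin m → Fin k, F j = ∑ σ : Equiv.Perm (Fin m), ∑ j ∈ A.J σ, F j := by
  classical
  have hdisj : Set.PairwiseDisjoint (↑(Finset.univ : Finset (Equiv.Perm (Fin m)))) A.J :=
    fun σ _ τ _ hne => A.disjoint σ τ hne
  rw [← Finset.sum_biUnion hdisj, A.biUnion_eq_univ]

/-- (2.6) and (2.7) chained, for a graph expression `E` multilinear in the m line propagators:
"E(G′) = Σ_{orderings l̃} Σ_{j∈J(l̃)} E(G′(j))". [cite: Balaban1983Higgs3, (2.6)–(2.7) pp.424–425] -/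
theorem display27_multilinear {S V W : Type} [CommSemiring S] [AddCommMonoid V] [AddCommMonoid W] [Module S V]
    [Module S W] {m k : ℕ} (A : Assignment m k) (E : MultilinearMap S (fun _ : Fin m => V) W)
    (P : Fin m → Fin k → V) :
    E (fun l => ∑ j : Fin k, P l j)
      = ∑ σ : Equiv.Perm (Fin m), ∑ j ∈ A.J σ, E (fun l => P l (j l)) := by
  rw [sum_multiIndex, display27 A]

/-! ### "The part of this sum with indices j different …" -/

/-- kernel: for pairwise different indices ("indices j different" — `j` injective) there is EXACTLY ONE ordering of the
lines along which the indices increase strictly (existence: the sorting permutation; uniqueness: `Tuple.unique_monotone`).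
[folklore] -/
theorem existsUnique_strictlyOrderedAlong {m k : ℕ} (j : Fin m → Fin k) (hj : Function.Injective j) :
    ∃! σ : Equiv.Perm (Fin m), StrictlyOrderedAlong σ j := by
  refine ⟨Tuple.sort j, (Tuple.monotone_sort j).strictMono_of_injective (hj.comp (Tuple.sort j).injective), ?_⟩
  intro τ hτ
  have h : j ∘ τ = j ∘ Tuple.sort j := Tuple.unique_monotone hτ.monotone (Tuple.monotone_sort j)
  exact Equiv.ext fun i => hj (congrFun h i)

/-- kernel: a multi-index strictly ordered along some ordering has pairwise different entries. [folklore] -/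
theorem injective_of_strictlyOrderedAlong {m k : ℕ} {σ : Equiv.Perm (Fin m)} {j : Fin m → Fin k}
    (h : StrictlyOrderedAlong σ j) : Function.Injective j := by
  have hcomp : Function.Injective ((j ∘ σ) ∘ σ.symm) := h.injective.comp σ.symm.injective
  have e : (j ∘ σ) ∘ σ.symm = j := by
    funext x
    simp
  rwa [e] at hcomp

open Classical in
/-- "The part of this sum with indices j different can be represented in a natural way as a sum over orderings of the
lines and for fixed ordering l̃ = {l(1), …, l(m)} a sum over indices j satisfying the condition
j_{l(1)} < j_{l(2)} < … < j_{l(m)}." — kernel: here no choice is involved, the strictly ordered classes partition the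
injective multi-indices. [cite: Balaban1983Higgs3, p.424] -/
theorem display27_strict {W : Type} [AddCommMonoid W] {m k : ℕ} (F : (Fin m → Fin k) → W) :
    ∑ j ∈ Finset.univ.filter (fun j : Fin m → Fin k => Function.Injective j), F j
      = ∑ σ : Equiv.Perm (Fin m), ∑ j ∈ Finset.univ.filter (fun j => StrictlyOrderedAlong σ j), F j := by
  have hdisj : Set.PairwiseDisjoint (↑(Finset.univ : Finset (Equiv.Perm (Fin m))))
      (fun σ => Finset.univ.filter (fun j : Fin m → Fin k => StrictlyOrderedAlong σ j)) := by
    intro σ _ τ _ hne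
    simp only [Function.onFun]
    rw [Finset.disjoint_left]
    intro j h1 h2
    have h1' : StrictlyOrderedAlong σ j := (Finset.mem_filter.1 h1).2
    have h2' : StrictlyOrderedAlong τ j := (Finset.mem_filter.1 h2).2
    exact hne ((existsUnique_strictlyOrderedAlong j (injective_of_strictlyOrderedAlong h1')).unique h1' h2')
  rw [← Finset.sum_biUnion hdisj]
  refine Finset.sum_congr ?_ fun _ _ => rfl
  ext j
  simp only [Finset.mem_filter, Finset.mem_univ, true_and, Finset.mem_biUnion]
  constructor
  · intro hj
    obtain ⟨σ, hσ, -⟩ := existsUnique_strictlyOrderedAlong j hj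
    exact ⟨σ, hσ⟩
  · rintro ⟨σ, hσ⟩
    exact injective_of_strictlyOrderedAlong hσ

/-- "To prove the theorem it is sufficient to prove the estimate (1.33) for the sum with fixed ordering l̃ on the right
side above." — the bookkeeping half of that sentence, kernel-checked: a bound `B` for each of the inner sums of (2.7)
bounds the whole by (number of orderings) · B = m! · B (in an ordered additive commutative monoid; the paper's (1.33)
absorbs such combinatorial factors into its constants — that absorption is NOT modelled). [folklore] -/
theorem sum_le_card_orderings_nsmul {W : Type} [AddCommMonoid W] [PartialOrder W] [IsOrderedAddMonoid W]
    {m k : ℕ} (A : Assignment m k) (F : (Fin m → Fin k) → W) (B : W)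
    (hB : ∀ σ : Equiv.Perm (Fin m), ∑ j ∈ A.J σ, F j ≤ B) :
    ∑ j : Fin m → Fin k, F j ≤ Nat.factorial m • B := by
  rw [display27 A]
  calc ∑ σ : Equiv.Perm (Fin m), ∑ j ∈ A.J σ, F j
      ≤ ∑ _σ : Equiv.Perm (Fin m), B := Finset.sum_le_sum fun σ _ => hB σ
    _ = Nat.factorial m • B := by
        rw [Finset.sum_const, Finset.card_univ, Fintype.card_perm, Fintype.card_fin]

end Literature.MathematicalPhysics.QuantumFieldTheory.Balaban1983to89.B3
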